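import Mathlib
import Summits.ValiantsHypothesis.ValiantsHypothesis.Theses.NewtonUnitEquations
import HarnessLib

/-!
# Route NewtonUnitEquations — crux `TwoProducts` (stmt-ValiantsHypothesis-5906), line `mahler-radix-recursion`: objects

Definitions file for the registered line `Cruxes/TwoProducts/Lines/mahler-radix-recursion.lean` (induction on
scales: peel one factor pair, `∏ f − ∏ g = f_i · W_i + (f_i − g_i) · S_i`; NOT the item's skeleton of record),
whose stubs (α) `stub_outerVertices` ("provable now"), (β) `stub_hiddenVertices` (OPEN core) and (β_r)
`stub_radixScaleStep` (OPEN regime engine) and whose two compositions (`TwoProducts_of`, `radixTwoProducts_of`) are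
stated over objects the line declares locally.  This file puts them VERBATIM (same names, same bodies, same order)
into an importable module so that the line's stubs and compositions can be proved by name in `Theorems/`:

* `Poly` — bivariate complex polynomials; `ι` — the planar point of an exponent vector; `Vx A` — the vertex set of
  the lattice polygon `conv A`; `vert W` — the number of vertices of `Newt(W)` (definitionally the crux's count);
* `coarseDiff f g i` — `W_i = ∏_{j ≠ i} f_j − ∏_{j ≠ i} g_j`; `coarseProd g i` — `S_i = ∏_{j ≠ i} g_j`;
  `peelFrame f g i` — `supp(f_i W_i) ∪ supp((f_i − g_i) S_i)`; `hidden f g i` — the number of vertices of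
  `Newt(∏ f − ∏ g)` that are not vertices of the frame hull;
* `gterm`, `F` — the step term and the recursion bound of the induction on scales;
* `radix b D` — radix factors `D_j(X^{b^j}, Y^{b^j})`; `H` — the additive recursion bound of the radix regime.

No statement is asserted here.  Honest framing: vocabulary only; the crux `TwoProducts` is OPEN (the line rests on
its open core `stub_hiddenVertices`; the radix regime on `stub_radixScaleStep`), the line is not the item's skeleton
of record, and nothing here bears on `VP ≠ VNP`.
-/

noncomputable section

-- Sub = Summit single-conjunct layout: the duplicated namespace component is mandated by the tree.
set_option linter.dupNamespace false

namespace Summit.ValiantsHypothesis.ValiantsHypothesis.Theorems.NewtonUnitEquations.TwoProducts.MahlerRadixRecursion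

open scoped BigOperators
open MvPolynomial

/-! ## Vertex counts -/

/-- Bivariate complex polynomials (verbatim the line's `Poly`). [folklore] -/
abbrev Poly := MvPolynomial (Fin 2) ℂ

/-- The planar point of an exponent vector, exactly as inlined in the crux (verbatim the line's `ι`). [folklore] -/
abbrev ι : (Fin 2 →₀ ℕ) → (Fin 2 → ℝ) := fun e i => ((e i : ℕ) : ℝ)

/-- Vertex set of the lattice polygon `conv(A)` of a finite exponent set `A` (verbatim the line's `Vx`). [folklore] -/
abbrev Vx (A : Finset (Fin 2 →₀ ℕ)) : Set (Fin 2 → ℝ) :=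
  Set.extremePoints ℝ (convexHull ℝ (ι '' (A : Set (Fin 2 →₀ ℕ))))

/-- Number of vertices of the Newton polygon of `W` (definitionally the crux's count and the Literature
abbreviation `newtonVertexCount`; verbatim the line's `vert`). [folklore] -/
abbrev vert (W : Poly) : ℕ := (Vx W.support).ncard

/-! ## Peeling one factor pair (one scale) -/

/-- The COARSE DIFFERENCE after peeling the pair `(f_i, g_i)`: `W_i = ∏_{j ≠ i} f_j − ∏_{j ≠ i} g_j` — an
instance of the crux with one factor pair fewer (verbatim the line's `coarseDiff`). [folklore] -/
def coarseDiff {m : ℕ} (f g : Fin (m + 1) → Poly) (i : Fin (m + 1)) : Poly :=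
  ∏ j, f (i.succAbove j) - ∏ j, g (i.succAbove j)

/-- The COARSE PRODUCT `S_i = ∏_{j ≠ i} g_j` (verbatim the line's `coarseProd`). [folklore] -/
def coarseProd {m : ℕ} (g : Fin (m + 1) → Poly) (i : Fin (m + 1)) : Poly :=
  ∏ j, g (i.succAbove j)

/-- The PEEL FRAME: the union of the supports of the two summands of the splitting
`∏ f − ∏ g = f_i · W_i + (f_i − g_i) · S_i`; its hull `K_i` contains `Newt(∏ f − ∏ g)` (verbatim the line's
`peelFrame`). [folklore] -/
def peelFrame {m : ℕ} (f g : Fin (m + 1) → Poly) (i : Fin (m + 1)) : Finset (Fin 2 →₀ ℕ) :=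
  (f i * coarseDiff f g i).support ∪ ((f i - g i) * coarseProd g i).support

/-- HIDDEN (manufactured) vertices of the peel at `i`: vertices of `Newt(∏ f − ∏ g)` that are not vertices
of the frame hull `K_i`; they exist only through cancellation between the two summands on `∂K_i` (verbatim the
line's `hidden`). [folklore] -/
def hidden {m : ℕ} (f g : Fin (m + 1) → Poly) (i : Fin (m + 1)) : ℕ :=
  (Vx (∏ j, f j - ∏ j, g j).support \ Vx (peelFrame f g i)).ncard

/-! ## The recursion bookkeeping -/

/-- The added term of one step: `g(k) = (k+3)t + (k+t+2)^c` (verbatim the line's `gterm`). [folklore] -/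
def gterm (t c k : ℕ) : ℕ := (k + 3) * t + (k + t + 2) ^ c

/-- The recursion bound `F(0) = 0`, `F(k+1) = A·F(k) + g(k)` (verbatim the line's `F`). [folklore] -/
def F (A t c : ℕ) : ℕ → ℕ
  | 0 => 0
  | k + 1 => A * F A t c k + gterm t c k

/-! ## The radix regime -/

/-- Radix factors: `f_j = D_j(X^{b^j}, Y^{b^j}) = expand (b^j) D_j` (verbatim the line's `radix`). [folklore] -/
def radix (b : ℕ) {n : ℕ} (D : Fin n → Poly) : Fin n → Poly := fun j => expand (b ^ (j : ℕ)) (D j)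

/-- The additive recursion bound of the radix regime (verbatim the line's `H`). [folklore] -/
def H (t r κ : ℕ) : ℕ → ℕ
  | 0 => 0
  | k + 1 => H t r κ k + (k + 3) * t + (t + r + 2) ^ κ

end Summit.ValiantsHypothesis.ValiantsHypothesis.Theorems.NewtonUnitEquations.TwoProducts.MahlerRadixRecursion

end
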